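import Summits.QuantumFields.BalabanUV.T4Continuum.Support.VariationalVectorGaugeSliceTower

/-!
# T⁴ programme, spine node NE2 (U1a), lane P2 — LEAF V-GF, file 6: LEAF V-UB AND THE SURJECTIVITY SOCKET AT `U = 1` FOR BAŁABAN's GAUGE FUNCTIONAL —
# (GF1) `projG 1 K ≤ d·roughV_1`, hence the road owner's binder-free V-UB (`VariationalVectorForm.exists_ubV`) applies at flat data with the k-UNIFORM constant
# `lamV d 0 d 0`; the fine-level twin by transport (`ubV_transport`); `hsurj₁` from V-UB — three more sockets of the slice END inhabited at flat data (model level)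

NE2 formalisation swarm `b2b-balaban-t4-ne2-formalise-*`, leaf prover 09 GEN 7 (`prover-b2b-balaban-t4-ne2-formalise-leaf-09-g7-0`); follows files 1–5
(`VariationalVectorGaugeSlice{,Flat,B5,Tower,Value}`).  On top of the road owner's `VariationalVectorForm.{exists_ubV, lamV}` (p216339, leaf V-UB DISCHARGED for
the fixed form under (GF1) `G ≤ C_G·roughV + C₀·nsqV`), leaf-03-g4's `VectorLineTransport.QvT_eq_QvL` (p216509), leaf-10-g3's `VariationalVectorTower.{ubV_transport,
QvL_surjective_of_ub}` (p218948), this lineage's `VariationalVectorWeitzenbock.divSq_le_mul_roughV` (p218860) and file 1's `projG_le_divSq` — BY NAME.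

THE STATEMENTS (model level; `E` a finite-dimensional Hilbert space; flat data; `1 ≤ d`).
 * §1 (GF1) at flat data: **`projG_flat_le_rough`**: `projG 1 K W ≤ d·roughV n M 1 W` (any `K`), i.e. `C_G = d`, `C₀ = 0`;
 * §2 **`hUBc_flat`**: `∀ φ ∃ W, QvL n M 1 W = φ ∧ ScV n M 1 (projG 1 (ker Q′_1)) W ≤ lamV d 0 d 0 · nsqV M φ` — the END's `hUBc k` at flat data, constant
   `lamV d 0 d 0 = (60·6^{d−1})²·(2d(2+d)·13)` INDEPENDENT of the level; **`QvL_flat_surjective`** (the END's `hsurj₁`);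
 * §3 **`hUBf_flat`**: the fine-level twin `∀ φ ∃ W′, Q_n(Q_L W′) = φ ∧ SfV n L M 1 (projGf n L M) W′ ≤ lamV d 0 d 0 · nsqV M φ` (= `hUBc_flat` at level `n·L` through
   `ubV_transport`, `compL 1 1 = 1`, `Gtr_projGf`);
 * §4 tower forms `hUBc_tower`, `hUBf_tower`, `hsurj₁_tower` in the letters of `VariationalVectorEndOfLeavesSlice.towerLimitRate_effV_of_leaves_slice` (p221732) with
   file 4's `Gk`∕`Gk'`.
With files 4–6 the slice END at flat data for `G k := projG 1 (ker Q′_1)` has `hGm`∕`hG`∕`hTcomp`∕`hRtr`∕`hGtr`∕`hT′1`∕`hsurj₁`∕`hUBc`∕`hUBf`∕`hPc`∕`hPf`∕`hslice`∕`hσ`∕`hσ′`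
inhabited; displayed remain the curl Federbush `hFEDcurl`, V-ONE `hONE`, V-REG `hREG` and the uniform-constant ∕ decay bookkeeping.

HONEST FRAMING (T4-DAG p. 1).  Model level; flat data; [folklore] instantiation of landed lemmas; nothing printed is a hypothesis; no `def`, no `def … : Prop`,
no `sorry`; axioms standard.  V-GF∕V-P∕V-UB with background OPEN; V-END ∕ NE2 NOT proved; NE3 OPEN; spine PROVED 0∕9 unchanged; rung (B)+1 finite T⁴ — NOT
infinite volume, NOT mass gap, NOT Clay.  HONEST DEPENDENCY (cell, verbatim): continuum YM on T⁴ ⇐ BetaPertH ∧ nine spine estimates (0/9 proved); BetaPertH ⇐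
(D1) ∧ (D4) ∧ CAP+tail; G-an2-4 gates asym, D1 and NE2/3/4.
-/

noncomputable section

namespace Summit.QuantumFields.BalabanUV.T4Continuum.VariationalVectorGaugeSliceUB

open Literature.MathematicalPhysics.QuantumFieldTheory.Balaban1983to89.B5Prop11Plancherel (Tor fine unitVec)
open Summit.QuantumFields.BalabanUV.T4Continuum.VariationalVectorForm (ScV SfV lamV exists_ubV)
open Summit.QuantumFields.BalabanUV.T4Continuum.VectorBlockTrialForm (QvL QvT nsqV roughV QvT_eq_QvL compL)
open Summit.QuantumFields.BalabanUV.T4Continuum.VariationalVectorWeitzenbock (divSq_le_mul_roughV)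
open Summit.QuantumFields.BalabanUV.T4Continuum.VariationalColourTower (Rtrv)
open Summit.QuantumFields.BalabanUV.T4Continuum.VariationalVectorTower (Gtr ubV_transport QvL_surjective_of_ub)
open Summit.QuantumFields.BalabanUV.T4Continuum.VariationalVectorGaugeSlice (projG projG_le_divSq)
open Summit.QuantumFields.BalabanUV.T4Continuum.VariationalVectorGaugeSliceFlat (kerAvgFlat)
open Summit.QuantumFields.BalabanUV.T4Continuum.VariationalVectorGaugeSliceB5 (flatR)
open Summit.QuantumFields.BalabanUV.T4Continuum.VariationalVectorGaugeSliceTower (projGf Gk Gk' Rtrv_flat compL_flat Gtr_projGf)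

variable {d : ℕ}

section General

variable {E : Type*} [NormedAddCommGroup E] [InnerProductSpace ℂ E] [CompleteSpace E] [FiniteDimensional ℂ E]
variable (n : ℕ) [NeZero n] (M : Fin d → ℕ) [hM : ∀ μ, NeZero (M μ)]

/-! ## §1 (GF1) at flat data -/

/-- **(GF1) AT FLAT DATA**: `projG 1 K W ≤ d·roughV n M 1 W` (`projG ≤ divSq`, file 1; `divSq ≤ d·rough` for unitary transports, p218860). [folklore] -/
theorem projG_flat_le_rough (K : Submodule ℂ (Tor (fine n M) → E)) (W : Tor (fine n M) → Fin d → E) :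
    projG (fine n M) (fun _ _ => (1 : E →L[ℂ] E)) K W ≤ (d : ℝ) * roughV n M (fun _ _ => (1 : E →L[ℂ] E)) W :=
  (projG_le_divSq (fine n M) _ K W).trans (divSq_le_mul_roughV n M (fun _ _ => Submonoid.one_mem _) W)

/-! ## §2 Leaf V-UB and surjectivity at the coarse level, flat data -/

/-- **LEAF V-UB AT `U = 1` FOR BAŁABAN's GAUGE FUNCTIONAL** (the END's `hUBc k` at flat data): every unit-lattice 1-form `φ` has a preimage under the flat
line-sum average with `ScV n M 1 (projG 1 (ker Q′_1)) W ≤ lamV d 0 d 0 · nsqV M φ` — the owner's `exists_ubV` at `Tl = Sl = R = 1`, `w = 0`, `C_G = d`, `C₀ = 0`.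
[folklore] -/
theorem hUBc_flat (hd : 1 ≤ d) (φ : Tor M → Fin d → E) :
    ∃ W : Tor (fine n M) → Fin d → E, QvL n M (fun _ _ _ _ => (1 : E →L[ℂ] E)) W = φ ∧
      ScV n M (fun _ _ => (1 : E →L[ℂ] E)) (projG (fine n M) (fun _ _ => (1 : E →L[ℂ] E)) (kerAvgFlat n M)) W ≤ lamV d 0 d 0 * nsqV M φ := by
  have h := exists_ubV n M (Tl := fun _ _ => (1 : E →L[ℂ] E)) (Sl := fun _ _ => (1 : E →L[ℂ] E)) (fun _ _ _ => rfl)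
    (fun _ _ => ContinuousLinearMap.norm_id_le) (fun _ _ => ContinuousLinearMap.norm_id_le) (R := fun _ _ => (1 : E →L[ℂ] E))
    (fun _ _ => ContinuousLinearMap.norm_id_le) (w := 0) le_rfl (fun _ _ _ _ _ => by simp) hd (Nat.cast_nonneg d) le_rfl
    (G := projG (fine n M) (fun _ _ => (1 : E →L[ℂ] E)) (kerAvgFlat n M)) (fun W => by simpa using projG_flat_le_rough n M (kerAvgFlat n M) W) φ
  simpa [QvT_eq_QvL] using h

/-- **`hsurj₁` AT FLAT DATA**: the flat line-sum average is onto. [folklore] -/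
theorem QvL_flat_surjective (hd : 1 ≤ d) : Function.Surjective (QvL n M (fun _ _ _ _ => (1 : E →L[ℂ] E))) :=
  QvL_surjective_of_ub n M (hUBc_flat n M hd)

end General

/-! ## §3 Leaf V-UB at the fine level, flat data (`E = ℂ`, the END's carriers) -/

section Complex

variable (n L : ℕ) [NeZero n] [NeZero L] (M : Fin d → ℕ) [hM : ∀ μ, NeZero (M μ)]

/-- **LEAF V-UB AT THE FINE LEVEL, FLAT DATA** (the END's `hUBf k`): `∀ φ ∃ W′, Q_n(Q_L W′) = φ ∧ SfV n L M 1 (projGf n L M) W′ ≤ lamV d 0 d 0 · nsqV M φ` —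
`hUBc_flat` at level `n·L` carried through `ubV_transport` (`compL 1 1 = 1`, `Rtrv 1 = 1`, `Gtr (projGf) = projG`). [folklore] -/
theorem hUBf_flat (hd : 1 ≤ d) (φ : Tor M → Fin d → ℂ) :
    ∃ W' : Tor (fine L (fine n M)) → Fin d → ℂ,
      QvL n M (fun _ _ _ _ => (1 : ℂ →L[ℂ] ℂ)) (QvL L (fine n M) (fun _ _ _ _ => (1 : ℂ →L[ℂ] ℂ)) W') = φ ∧
      SfV n L M (flatR L (fine n M)) (projGf n L M) W' ≤ lamV d 0 d 0 * nsqV M φ := by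
  obtain ⟨W, hW, hb⟩ := hUBc_flat (n * L) M hd φ
  refine (ubV_transport n L M).mpr ⟨W, ?_, ?_⟩
  · rw [compL_flat]; exact hW
  · rw [Rtrv_flat, Gtr_projGf]; exact hb

/-! ## §4 Tower forms in the slice END's letters -/

/-- `hUBc k` at flat data, `Λ k = lamV d 0 d 0` for every `k`. [folklore] -/
theorem hUBc_tower (hd : 1 ≤ d) (k : ℕ) (φ : Tor M → Fin d → ℂ) :
    ∃ W, QvL (L ^ k) M (fun _ _ _ _ => (1 : ℂ →L[ℂ] ℂ)) W = φ ∧ ScV (L ^ k) M (flatR (L ^ k) M) (Gk L M k) W ≤ lamV d 0 d 0 * nsqV M φ :=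
  hUBc_flat (L ^ k) M hd φ

/-- `hUBf k` at flat data. [folklore] -/
theorem hUBf_tower (hd : 1 ≤ d) (k : ℕ) (φ : Tor M → Fin d → ℂ) :
    ∃ W', QvL (L ^ k) M (fun _ _ _ _ => (1 : ℂ →L[ℂ] ℂ)) (QvL L (fine (L ^ k) M) (fun _ _ _ _ => (1 : ℂ →L[ℂ] ℂ)) W') = φ ∧
      SfV (L ^ k) L M (flatR L (fine (L ^ k) M)) (Gk' L M k) W' ≤ lamV d 0 d 0 * nsqV M φ :=
  hUBf_flat (L ^ k) L M hd φ

/-- `hsurj₁ k` at flat data. [folklore] -/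
theorem hsurj₁_tower (hd : 1 ≤ d) (k : ℕ) : Function.Surjective (QvL L (fine (L ^ k) M) (fun _ _ _ _ => (1 : ℂ →L[ℂ] ℂ))) :=
  QvL_flat_surjective L (fine (L ^ k) M) hd

end Complex

end Summit.QuantumFields.BalabanUV.T4Continuum.VariationalVectorGaugeSliceUB

end
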